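import Literature.AlgebraicGeometry.Resolution.DiffOpBlowupShiftLaw
import Literature.AlgebraicGeometry.Resolution.BlowupStalkCharts
import Literature.AlgebraicGeometry.Resolution.StalkIdealLemmas
import Literature.AlgebraicGeometry.Resolution.DerivativeIdealSheaf
import HarnessLib

/-!
# Giraud's shift law for `Diff^{≤ n}` on the local rings of a blowing up

Topic: `Literature/AlgebraicGeometry/Resolution`. The stalk-level assembly of `DiffOpBlowupShiftLaw.lean`. Let
`π : X′ → X` be a blowing up along the ideal sheaf `J` (`IsBlowup π J`, universal property, `Blowups.lean`) of a
scheme `X` with a `k`-structure `φ : k → Γ(X, 𝒪_X)` (stalks are `k`-algebras through `stalkAlgebra φ x`,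
`DerivativeIdealSheaf.lean`; `X′` carries the induced structure `π^* ∘ φ`), `x′ ∈ X′`, `x = π x′`, with `J_x`
finitely generated, and let `𝔷 ∈ 𝒪_{X,x}` be an **exceptional parameter at `x′`**: `π^*_{x′}(𝔷)` generates the
exceptional ideal `(π⁻¹J · 𝒪_{X′})_{x′}`. Then (`IsBlowup.exists_isDiffOpLE_stalk_shift`):

  **for every `k`-linear differential operator `D` of order `≤ n` of `𝒪_{X,x}` and every shift `N : ℕ` there is a
  `k`-linear differential operator `Δ` of order `≤ n` of `𝒪_{X′,x′}` with
  `zⁿ · π^*(D h) = z^N · Δ(w)` whenever `π^*(h) = z^N · w`** (`z = π^*𝔷`, `h ∈ 𝒪_{X,x}`, `w ∈ 𝒪_{X′,x′}`).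

For `N = 0` this says that `zⁿ · D` extends to the local ring of the blowing up (Giraud's lemma, [BGV 2012] Lemma
4.6: `I(H)ⁿ · Diff^{≤n}_X ⊆ Diff^{≤n}_{X′}` after restriction); the shift `N` is the form in which the lemma is
consumed when `π^*(h) = z^N w` is divided by the exceptional parameter.

* `exists_isDiffOpLE_shift_of_chart` — the ring-level dictionary: `φ : R → O′` a `k`-algebra map factoring as
  `R → R[I/a] → O′` with `O′` a localization of the chart and `(z) = I · O′`; then the shift law holds along `φ`
  for `z` (from `exists_isDiffOpLE_shift_of_isLocalization_blowupAlgebra` for the chart parameter `a` and the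
  generator change `exists_isDiffOpLE_shift_of_mem_span`, `I · R[I/a] = (a)`).
* `IsBlowup.exists_isDiffOpLE_stalk_shift` — the statement above: `𝒪_{X′,x′}` is a localization of a chart
  `𝒪_{X,x}[J_x/c_j]` of the blowing up of `Spec 𝒪_{X,x}` (`IsBlowup.exists_reesChart_stalk`, `BlowupStalkCharts.lean`;
  `(R[It])_{(c_j t)} ≅ R[I/c_j]`, `reesChartEquiv`), and `(π⁻¹J · 𝒪_{X′})_{x′} = J_x · 𝒪_{X′,x′}`
  (`stalkIdeal_comap_eq_map_stalkMap`).

Motivation (cell `res-hironaka`, campaign D-0089; nothing of the manuscript under adjudication is asserted here): this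
is the hypothesis shape «(HG) Giraud shift law» of the adjudication of row R34 (Th. 7.12), a theorem for every
blowing up; its instantiation at that row's telescope is `Hironaka2017/Proofs/S07Permissible/Thm712GiraudShift.lean`.

## Sources

* A. Bravo, M. L. García-Escamilla, O. Villamayor U., arXiv:1107.1797, Lemma 4.6 (Giraud's Lemma) p. 15.
  [BravoGarciaEscamillaVillamayor2012]
* The Stacks Project, Tag 0804 (charts of a blowing up; local rings of the blowing up). [StacksProject]
-/

noncomputable section

open CategoryTheory AlgebraicGeometry TopologicalSpace IsLocalRing IsLocalization

namespace Literature.AlgebraicGeometry.Resolution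

universe u v w w'

/-! ## The ring-level dictionary: a `k`-algebra map through a chart -/

section Chart

variable {k : Type u} [CommRing k] {R : Type v} {O' : Type w} [CommRing R] [CommRing O'] [Algebra k R]
  [Algebra k O']

/-- **The shift law along a map that factors through a localized chart.** Let `φ : R → O′` be compatible with the
`k`-structures, `a ∈ I ⊆ R`, `χ : R[I/a] → O′` over `R` presenting `O′` as a localization `M⁻¹ R[I/a]`, and
`z ∈ O′` with `(z) = I · O′`. Then for every `k`-linear differential operator `D` of order `≤ n` of `R` and every
`N` there is a `k`-linear differential operator `Δ` of order `≤ n` of `O′` with `zⁿ · φ(D h) = z^N · Δ(w)` whenever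
`φ(h) = z^N · w`. [cite: BravoGarciaEscamillaVillamayor2012, Lemma 4.6 p.15 (Giraud's Lemma), localized, via StacksProject Tag 0804 / Tag 07Z3 (2) (I · R[I/a] = (a))] -/
theorem exists_isDiffOpLE_shift_of_chart (φ : R →+* O') (hφk : ∀ c : k, φ (algebraMap k R c) = algebraMap k O' c)
    {I : Ideal R} {a : R} (ha : a ∈ I) (χ : blowupAlgebra I a →+* O')
    (hχ : ∀ r : R, χ (algebraMap R (blowupAlgebra I a) r) = φ r) (M : Submonoid (blowupAlgebra I a))
    (hM : @IsLocalization _ _ M O' _ χ.toAlgebra) {z : O'} (hz : Ideal.span {z} = I.map φ)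
    (n N : ℕ) (D : R →ₗ[k] R) (hD : IsDiffOpLE k n D) :
    ∃ Δ : O' →ₗ[k] O', IsDiffOpLE k n Δ ∧
      ∀ (h : R) (w : O'), φ h = z ^ N * w → z ^ n * φ (D h) = z ^ N * Δ w := by
  letI := χ.toAlgebra
  haveI := hM
  have hφ' : ∀ r : R, algebraMap (blowupAlgebra I a) O' (algebraMap R (blowupAlgebra I a) r) = φ r := hχ
  haveI : IsScalarTower k (blowupAlgebra I a) O' := by
    refine IsScalarTower.of_algebraMap_eq fun x => ?_
    rw [IsScalarTower.algebraMap_apply k R (blowupAlgebra I a), hφ', hφk]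
  -- the law for the chart parameter `u = φ(a)`
  have H : ∀ (n N : ℕ) (D : R →ₗ[k] R), IsDiffOpLE k n D →
      ∃ Δ : O' →ₗ[k] O', IsDiffOpLE k n Δ ∧
        ∀ (h : R) (w : O'), φ h = φ a ^ N * w → φ a ^ n * φ (D h) = φ a ^ N * Δ w := by
    intro n N D hD
    obtain ⟨Δ, hΔ, hlaw⟩ :=
      exists_isDiffOpLE_shift_of_isLocalization_blowupAlgebra k (O' := O') M ha n N hD
    refine ⟨Δ, hΔ, fun h w hw => ?_⟩
    have := hlaw h w (by rw [hφ', hφ']; exact hw)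
    rwa [hφ', hφ'] at this
  -- `(z) = I · O' = (φ a)`
  have hu : I.map φ = Ideal.span {φ a} := by
    have hcomp : (algebraMap (blowupAlgebra I a) O').comp (algebraMap R (blowupAlgebra I a)) = φ :=
      RingHom.ext hφ'
    conv_lhs => rw [← hcomp, ← Ideal.map_map]
    rw [map_blowupAlgebra_eq_span ha, Ideal.map_span, Set.image_singleton, hφ']
  rw [hu] at hz
  have hz1 : z ∈ Ideal.span {φ a} := hz ▸ Ideal.mem_span_singleton_self z
  have hz2 : φ a ∈ Ideal.span {z} := hz.symm ▸ Ideal.mem_span_singleton_self (φ a)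
  obtain ⟨ε₁, hε₁⟩ := Ideal.mem_span_singleton'.mp hz1
  obtain ⟨ε₂, hε₂⟩ := Ideal.mem_span_singleton'.mp hz2
  exact exists_isDiffOpLE_shift_of_mem_span φ hε₁.symm hε₂.symm H n N D hD

end Chart

/-! ## The stalks of a blowing up -/

section Stalk

variable {X X' : Scheme.{u}} {π : X' ⟶ X} {J : X.IdealSheafData} {k : Type v} [CommRing k]

/-- The stalk maps of `π` are `k`-algebra maps for the induced `k`-structure `π^* ∘ φ` on `X′` (file-local copy of
`stalkMap_comp_stalkHom`, `KollarMaximalContact.lean`). [folklore] -/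
private theorem stalkMap_stalkHom_apply (φ : k →+* Γ(X, ⊤)) (x' : X') (c : k) :
    (π.stalkMap x').hom (stalkHom φ (π x') c) = stalkHom (π.appTop.hom.comp φ) x' c := by
  unfold stalkHom
  simp only [RingHom.comp_apply]
  exact Scheme.Hom.germ_stalkMap_apply π ⊤ x' trivial (φ c)

/-- **Giraud's shift law on the local rings of a blowing up.** Let `π : X′ → X` be a blowing up along `J`
(`IsBlowup π J`), `φ : k → Γ(X, 𝒪_X)` a `k`-structure (stalk `k`-algebras `stalkAlgebra φ (π x′)` and
`stalkAlgebra (π^* ∘ φ) x′`), `x′ ∈ X′` with `J_{π x′}` finitely generated, and `𝔷 ∈ 𝒪_{X,π x′}` with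
`(π^*𝔷) = (π⁻¹J · 𝒪_{X′})_{x′}`. Then for every `k`-linear differential operator `D` of order `≤ n` of `𝒪_{X,π x′}` and
every `N : ℕ` there is a `k`-linear differential operator `Δ` of order `≤ n` of `𝒪_{X′,x′}` such that
`(π^*𝔷)ⁿ · π^*(D h) = (π^*𝔷)^N · Δ(w)` whenever `π^*(h) = (π^*𝔷)^N · w`.
[cite: BravoGarciaEscamillaVillamayor2012, Lemma 4.6 p.15 (Giraud's Lemma), on the local rings of the blowing up via StacksProject Tag 0804] -/
theorem IsBlowup.exists_isDiffOpLE_stalk_shift (hπ : IsBlowup π J) (φ : k →+* Γ(X, ⊤)) (x' : X')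
    (hfg : (stalkIdeal J (π x')).FG) (𝔷 : X.presheaf.stalk (π x'))
    (hspan : Ideal.span {(π.stalkMap x').hom 𝔷} = stalkIdeal (J.comap π) x') :
    letI := stalkAlgebra φ (π x')
    letI := stalkAlgebra (π.appTop.hom.comp φ) x'
    ∀ (n N : ℕ) (D : X.presheaf.stalk (π x') →ₗ[k] X.presheaf.stalk (π x')), IsDiffOpLE k n D →
      ∃ Δ : X'.presheaf.stalk x' →ₗ[k] X'.presheaf.stalk x', IsDiffOpLE k n Δ ∧
        ∀ (h : X.presheaf.stalk (π x')) (w : X'.presheaf.stalk x'),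
          (π.stalkMap x').hom h = (π.stalkMap x').hom 𝔷 ^ N * w →
            (π.stalkMap x').hom 𝔷 ^ n * (π.stalkMap x').hom (D h) = (π.stalkMap x').hom 𝔷 ^ N * Δ w := by
  letI algR : Algebra k (X.presheaf.stalk (π x')) := stalkAlgebra φ (π x')
  letI algO : Algebra k (X'.presheaf.stalk x') := stalkAlgebra (π.appTop.hom.comp φ) x'
  intro n N D hD
  -- generators of `J_x` and a chart of `Bl_{J_x}(Spec 𝒪_{X,x})` through `x'`
  obtain ⟨m, c, hc⟩ := Submodule.fg_iff_exists_fin_generating_family.mp hfg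
  obtain ⟨j, 𝔴, χ, hχ, hloc, -⟩ := hπ.exists_reesChart_stalk x' c hc
  have ha : c j ∈ Ideal.span (Set.range c) := Ideal.mem_span_range_self (f := c) (x := j)
  -- `ε : B_j ≅ R[I/c_j]`; `χ' = χ ∘ ε⁻¹ : R[I/c_j] → 𝒪_{X',x'}` presents the stalk as a localization
  have hεb : ∀ r : X.presheaf.stalk (π x'),
      (reesChartEquiv (c j) ha).symm (algebraMap _ (blowupAlgebra (Ideal.span (Set.range c)) (c j)) r) =
        chartBase c j r := fun r => by
    rw [← reesChartEquiv_reesChartBase (c j) ha r, RingEquiv.symm_apply_apply]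
  have hχ' : ∀ r : X.presheaf.stalk (π x'),
      (χ.comp (reesChartEquiv (c j) ha).symm.toRingHom)
        (algebraMap _ (blowupAlgebra (Ideal.span (Set.range c)) (c j)) r) = (π.stalkMap x').hom r := fun r => by
    rw [RingHom.comp_apply, RingEquiv.toRingHom_eq_coe, RingHom.coe_coe, hεb, hχ]
  have hM : @IsLocalization _ _ (𝔴.asIdeal.primeCompl.map (reesChartEquiv (c j) ha).toMonoidHom)
      (X'.presheaf.stalk x') _ (χ.comp (reesChartEquiv (c j) ha).symm.toRingHom).toAlgebra := by
    letI := χ.toAlgebra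
    haveI := hloc
    exact IsLocalization.isLocalization_of_base_ringEquiv 𝔴.asIdeal.primeCompl (X'.presheaf.stalk x')
      (reesChartEquiv (c j) ha)
  -- `(π^*𝔷) = (π⁻¹J 𝒪_{X'})_{x'} = J_x · 𝒪_{X',x'}`
  have hz : Ideal.span {(π.stalkMap x').hom 𝔷} = (Ideal.span (Set.range c)).map (π.stalkMap x').hom := by
    rw [hspan, stalkIdeal_comap_eq_map_stalkMap, ← hc]
  exact exists_isDiffOpLE_shift_of_chart (π.stalkMap x').hom (fun x => stalkMap_stalkHom_apply φ x' x) ha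
    (χ.comp (reesChartEquiv (c j) ha).symm.toRingHom) hχ' _ hM hz n N D hD

end Stalk

end Literature.AlgebraicGeometry.Resolution

end
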